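import Literature.MathematicalPhysics.QuantumFieldTheory.Balaban1983to89.Beta.PeriodicDescent

/-!
# Pointwise stencils of the torus adjoints `δ0 = d0ᵀ`, `δ1 = d1ᵀ`, `Qᵀ`, and the descent dictionary periodic `ℤ^d` ↔ one-block torus

HONEST FRAMING (cell rule, verbatim): «discharging BetaPertH makes Balaban's UV stability UNCONDITIONAL — a real
constructive-QFT result; it is NOT the continuum limit and NOT the Clay problem.»  This module is [folklore],
Mathlib-elementary GLUE for the (B3-loc) descent step of the cell record `HOME/BETA/AN2.md` §11 (Y12)/(Y15): nothing of
the manuscripts under audit is asserted; the Bałaban references (B9 (3.21)–(3.23) p.394, B5 (1.55)–(1.63)) are CONTEXT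
LOCATORS only.  NOT summit progress; NOT continuum, NOT Clay.

Content.
* §1 The adjoints of the one-block torus operators of `Beta.OneBlockTorusKKT` (defined there abstractly as
  `LinearMap.adjoint` for the Euclidean inner products) computed as finite-difference STENCILS:
  `adjoint_d0_eq` (codifferential of a 1-cochain: `Σ_κ (D_κ(x − e_κ) − D_κ(x))`, the torus copy of
  `AffineAveraging.codiff₁`), `adjoint_d1_eq` (the torus copy of `AffineAveraging.curvAdj`), `adjoint_Q_eq`
  (`Qᵀ φ = N • const φ`: on one block the adjoint of the straight-contour sum is a CONSTANT cochain).
* §2 The descent dictionary: lifts are injective (`lift0/lift1_injective`), every `N`-periodic 1-form on `ℤ^d` is a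
  lift (`eq_lift1_of_isPeriodic1`), and the `ℤ^d` stencils of a lift are the lifts of the packaged torus vectors'
  images under `d0`, `adjoint d0`, `adjoint d1 ∘ d1`, `Q` (`dz_lift0_mk`, `codiff₁_lift1_mk`, `curvAdj_curv_lift1_mk`,
  `contourSum_lift1_mk`), so that a periodic solution of the `ℤ^d` one-block-data KKT system IS a solution of the torus
  system of `OneBlockTorusKKT.oneBlock_uniqueness'`.
-/

namespace Literature.MathematicalPhysics.QuantumFieldTheory.Balaban1983to89.Beta.OneBlockTorusKKT

open scoped InnerProductSpace
open Literature.Probability.LatticeModels (TorusSite Torus.proj Torus.proj_apply)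
open AffineAveraging (Form0 Form1 Form2 unitVec dz curv curvAdj codiff₁ box toSite blockSum contourSum)
open PeriodicDescent
open LatticeForm (repZ proj_repZ)

variable {d N : ℕ} [NeZero N]

/-! ## §1 Adjoint stencils on the one-block torus -/

/-- The Euclidean inner product of two real Euclidean vectors is the sum of the products of entries. [folklore] -/
theorem inner_eq_sum {α : Type*} [Fintype α] (u v : EuclideanSpace ℝ α) : ⟪u, v⟫_ℝ = ∑ a, u a * v a := by
  rw [PiLp.inner_apply]
  refine Finset.sum_congr rfl fun a _ => ?_
  simp [mul_comm]

/-- **δ0 AS A STENCIL**: `(d0ᵀ D)(x) = Σ_κ (D_κ(x − e_κ) − D_κ(x))` — the torus copy of `AffineAveraging.codiff₁`. [folklore] -/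
theorem adjoint_d0_eq (D : C1 d N) :
    LinearMap.adjoint d0 D = mk (fun x : 𝕋 d N => ∑ κ : Fin d, (D (κ, x - e κ) - D (κ, x))) := by
  refine ext_inner_right ℝ fun u => ?_
  rw [LinearMap.adjoint_inner_left, inner_eq_sum, inner_eq_sum, Fintype.sum_prod_type]
  simp only [d0_apply, mk_apply, Finset.sum_mul]
  conv_rhs => rw [Finset.sum_comm]
  refine Finset.sum_congr rfl fun κ _ => ?_
  have h : ∑ x : 𝕋 d N, D (κ, x) * u (x + e κ) = ∑ x : 𝕋 d N, D (κ, x - e κ) * u x := by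
    refine (Fintype.sum_equiv (Equiv.addRight (e κ)) _ _ fun x => ?_)
    simp [Equiv.addRight]
  simp only [mul_sub, sub_mul, Finset.sum_sub_distrib]
  rw [h]

/-- **δ1 AS A STENCIL**: `(d1ᵀ F)_μ(y) = Σ_l (F_{μl}(y) − F_{μl}(y − e_l)) + Σ_κ (F_{κμ}(y − e_κ) − F_{κμ}(y))` — the torus copy
of `AffineAveraging.curvAdj`. [folklore] -/
theorem adjoint_d1_eq (F : C2 d N) :
    LinearMap.adjoint d1 F = mk (fun p : Fin d × 𝕋 d N =>
      (∑ l : Fin d, (F ((p.1, l), p.2) - F ((p.1, l), p.2 - e l)))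
        + ∑ κ : Fin d, (F ((κ, p.1), p.2 - e κ) - F ((κ, p.1), p.2))) := by
  refine ext_inner_right ℝ fun D => ?_
  rw [LinearMap.adjoint_inner_left, inner_eq_sum, inner_eq_sum, Fintype.sum_prod_type, Fintype.sum_prod_type,
    Fintype.sum_prod_type]
  simp only [d1_apply, mk_apply]
  -- expand the left side: Σ_κ Σ_l Σ_x F((κ,l),x) * (D(κ,x) + D(l,x+eκ) - D(κ,x+el) - D(l,x))
  have hL : ∀ κ l : Fin d, ∑ x : 𝕋 d N, F ((κ, l), x) * (D (κ, x) + D (l, x + e κ) - D (κ, x + e l) - D (l, x))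
      = (∑ x : 𝕋 d N, F ((κ, l), x) * D (κ, x)) + (∑ x : 𝕋 d N, F ((κ, l), x - e κ) * D (l, x))
        - (∑ x : 𝕋 d N, F ((κ, l), x - e l) * D (κ, x)) - ∑ x : 𝕋 d N, F ((κ, l), x) * D (l, x) := by
    intro κ l
    have h1 : ∑ x : 𝕋 d N, F ((κ, l), x) * D (l, x + e κ) = ∑ x : 𝕋 d N, F ((κ, l), x - e κ) * D (l, x) := by
      refine Fintype.sum_equiv (Equiv.addRight (e κ)) _ _ fun x => ?_
      simp [Equiv.addRight]
    have h2 : ∑ x : 𝕋 d N, F ((κ, l), x) * D (κ, x + e l) = ∑ x : 𝕋 d N, F ((κ, l), x - e l) * D (κ, x) := by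
      refine Fintype.sum_equiv (Equiv.addRight (e l)) _ _ fun x => ?_
      simp [Equiv.addRight]
    simp only [mul_add, mul_sub, Finset.sum_add_distrib, Finset.sum_sub_distrib, h1, h2]
  simp only [hL]
  -- the right side: Σ_μ Σ_y (Σ_l (...) + Σ_κ (...)) * D(μ,y)
  simp only [add_mul, Finset.sum_mul, sub_mul, Finset.sum_add_distrib, Finset.sum_sub_distrib]
  -- match the four groups
  have e1 : ∑ κ : Fin d, ∑ l : Fin d, ∑ x : 𝕋 d N, F ((κ, l), x) * D (κ, x)
      = ∑ μ : Fin d, ∑ y : 𝕋 d N, ∑ l : Fin d, F ((μ, l), y) * D (μ, y) := by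
    refine Finset.sum_congr rfl fun μ _ => ?_
    rw [Finset.sum_comm]
  have e2 : ∑ κ : Fin d, ∑ l : Fin d, ∑ x : 𝕋 d N, F ((κ, l), x - e κ) * D (l, x)
      = ∑ μ : Fin d, ∑ y : 𝕋 d N, ∑ κ : Fin d, F ((κ, μ), y - e κ) * D (μ, y) := by
    rw [Finset.sum_comm]
    refine Finset.sum_congr rfl fun μ _ => ?_
    rw [Finset.sum_comm]
  have e3 : ∑ κ : Fin d, ∑ l : Fin d, ∑ x : 𝕋 d N, F ((κ, l), x - e l) * D (κ, x)
      = ∑ μ : Fin d, ∑ y : 𝕋 d N, ∑ l : Fin d, F ((μ, l), y - e l) * D (μ, y) := by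
    refine Finset.sum_congr rfl fun μ _ => ?_
    rw [Finset.sum_comm]
  have e4 : ∑ κ : Fin d, ∑ l : Fin d, ∑ x : 𝕋 d N, F ((κ, l), x) * D (l, x)
      = ∑ μ : Fin d, ∑ y : 𝕋 d N, ∑ κ : Fin d, F ((κ, μ), y) * D (μ, y) := by
    rw [Finset.sum_comm]
    refine Finset.sum_congr rfl fun μ _ => ?_
    rw [Finset.sum_comm]
  rw [e1, e2, e3, e4]
  ring

/-- **Qᵀ IS A CONSTANT COCHAIN**: on the one block, `Qᵀ φ = N • const φ` (each bond lies on exactly `N` straight contours of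
its direction, all inside the block). [folklore] -/
theorem adjoint_Q_eq (φ : W d) : LinearMap.adjoint Q φ = ((N : ℝ) • const φ : C1 d N) := by
  refine ext_inner_right ℝ fun D => ?_
  rw [LinearMap.adjoint_inner_left, inner_eq_sum, inner_eq_sum, Fintype.sum_prod_type]
  refine Finset.sum_congr rfl fun κ _ => ?_
  rw [blockSum_eq]
  simp only [PiLp.smul_apply, const_apply, smul_eq_mul, Finset.mul_sum]
  refine Finset.sum_congr rfl fun x _ => ?_
  ring

/-- Entries of `Qᵀ φ`. [folklore] -/
theorem adjoint_Q_apply (φ : W d) (κ : Fin d) (x : 𝕋 d N) :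
    (LinearMap.adjoint (Q : C1 d N →ₗ[ℝ] W d) φ : C1 d N) (κ, x) = (N : ℝ) * φ κ := by
  rw [adjoint_Q_eq]; simp

/-! ## §2 The descent dictionary -/

/-- Packaging a torus 1-form given as a function `Fin d → 𝕋 → ℝ` into the Euclidean vector of `C1`. [folklore] -/
def pack1 (D : Fin d → 𝕋 d N → ℝ) : C1 d N := mk fun p => D p.1 p.2

omit [NeZero N] in
/-- Entries of `pack1`. [folklore] -/
@[simp] theorem pack1_apply (D : Fin d → 𝕋 d N → ℝ) (κ : Fin d) (x : 𝕋 d N) : pack1 D (κ, x) = D κ x := rfl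

/-- Packaging a torus 0-form. [folklore] -/
def pack0 (u : 𝕋 d N → ℝ) : C0 d N := mk u

omit [NeZero N] in
/-- Entries of `pack0`. [folklore] -/
@[simp] theorem pack0_apply (u : 𝕋 d N → ℝ) (x : 𝕋 d N) : pack0 u x = u x := rfl

omit [NeZero N] in
/-- Re-packaging the entries of a vector gives it back. [folklore] -/
theorem pack1_entries (D : C1 d N) : pack1 (fun κ y => D (κ, y)) = D := by
  ext ⟨κ, y⟩; rfl

/-- `Torus.proj` is surjective (integer representatives). [folklore] -/
theorem proj_surjective : Function.Surjective (Torus.proj N : AffineAveraging.Site d → 𝕋 d N) :=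
  fun z => ⟨repZ z, proj_repZ z⟩

/-- Lifting 0-forms is injective. [folklore] -/
theorem lift0_injective : Function.Injective (lift0 (d := d) N) := by
  intro u v h
  funext z
  obtain ⟨x, rfl⟩ := proj_surjective (d := d) (N := N) z
  have := congrFun h x
  simpa using this

/-- Lifting 1-forms is injective. [folklore] -/
theorem lift1_injective : Function.Injective (lift1 (d := d) N) := by
  intro D D' h
  funext κ z
  obtain ⟨x, rfl⟩ := proj_surjective (d := d) (N := N) z
  have := congrFun (congrFun h κ) x
  simpa using this

/-- `N`-periodicity of a 1-form on `ℤ^d` (componentwise `IsPeriodic`). [folklore] -/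
def IsPeriodic1 (N : ℕ) (A : Form1 d ℝ) : Prop := ∀ κ, IsPeriodic N (A κ)

/-- Every `N`-periodic 1-form is the lift of a torus 1-form. [folklore] -/
theorem eq_lift1_of_isPeriodic1 (A : Form1 d ℝ) (hA : IsPeriodic1 N A) :
    A = lift1 N (fun κ z => A κ (repZ z)) := by
  funext κ x
  have h := congrFun (eq_lift0_of_isPeriodic (A κ) (hA κ)) x
  simpa using h

omit [NeZero N] in
/-- DICTIONARY (gradient): `dz (lift0 u) = lift1` of the entries of `d0 (pack0 u)`. [folklore] -/
theorem dz_lift0_pack (u : 𝕋 d N → ℝ) :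
    dz (lift0 N u) = lift1 N (fun κ y => d0 (pack0 u) (κ, y)) := by
  rw [dz_lift0]
  rfl

/-- DICTIONARY (codifferential): `codiff₁ (lift1 D) = lift0` of the entries of `d0ᵀ (pack1 D)`. [folklore] -/
theorem codiff₁_lift1_pack (D : Fin d → 𝕋 d N → ℝ) :
    codiff₁ (lift1 N D) = lift0 N (fun y => LinearMap.adjoint d0 (pack1 D) y) := by
  rw [codiff₁_lift1, adjoint_d0_eq]
  rfl

/-- DICTIONARY (Euler–Lagrange stencil): `curvAdj (curv (lift1 D)) = lift1` of the entries of `d1ᵀ (d1 (pack1 D))`. [folklore] -/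
theorem curvAdj_curv_lift1_pack (D : Fin d → 𝕋 d N → ℝ) :
    curvAdj (curv (lift1 N D)) = lift1 N (fun μ y => LinearMap.adjoint d1 (d1 (pack1 D)) (μ, y)) := by
  rw [curv_lift1, curvAdj_lift2, adjoint_d1_eq]
  funext μ x
  simp only [lift1_apply, mk_apply, d1_apply, pack1_apply]

/-- DICTIONARY (block average): the straight-contour block sum of `lift1 D` over ANY block is the entry of `Q (pack1 D)`. [folklore] -/
theorem contourSum_lift1_pack (D : Fin d → 𝕋 d N → ℝ) (κ : Fin d) (y : AffineAveraging.Site d) :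
    contourSum N (lift1 N D) κ y = Q (pack1 D) κ := by
  rw [contourSum_lift1, Q_apply]
  rfl

omit [NeZero N] in
/-- DICTIONARY (constants): the lift of the entries of `const c` is the constant 1-form. [folklore] -/
theorem lift1_const (c : W d) : lift1 N (fun κ y => (const c : C1 d N) (κ, y)) = fun κ _ => c κ := by
  funext κ x; simp

/-- DICTIONARY (weak gauge ⟹ torus gauge hypothesis of `gauge_descent`): if `u = lift0 v` and the `ℤ^d` field
`codiff₁ (dz u)` (minus the lattice Laplacian of `u`) is CONSTANT, then on the torus `d0 (d0ᵀ (d0 (pack0 v))) = 0`. [folklore] -/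
theorem d0_lap_pack_eq_zero_of_const (v : 𝕋 d N → ℝ) (t : ℝ) (h : ∀ x, codiff₁ (dz (lift0 N v)) x = t) :
    d0 (LinearMap.adjoint d0 (d0 (pack0 v))) = 0 := by
  have key : ∀ z : 𝕋 d N, LinearMap.adjoint d0 (d0 (pack0 v)) z = t := by
    intro z
    obtain ⟨x, rfl⟩ := proj_surjective (d := d) (N := N) z
    have hx := h x
    rw [dz_lift0_pack, codiff₁_lift1_pack, pack1_entries, lift0_apply] at hx
    exact hx
  ext ⟨κ, z⟩
  simp [key]

end Literature.MathematicalPhysics.QuantumFieldTheory.Balaban1983to89.Beta.OneBlockTorusKKT
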